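import Mathlib
import HarnessLib
import Literature.MathematicalPhysics.StatisticalMechanics.RenormalisationStepAlgebra
import Summits.HubbardSuperconductivity.HubbardSuperconductivity.Theorems.ComplexGFFStiffnessHypACumulantHolomorphicBlockFactors

/-!
# Crux `HypACumulant`, line `gnv` — structural pass, bricks 2–3: activities along an affine line
# `K + σV`, circle products `pcirc`, and the intermediate functional `Φ = midK` of (6.32) are
# jointly `C^n` and entire in the complex parameter `σ`

Route `route-HubbardSuperconductivity-ComplexGFFStiffness`, cruxes stmt-HubbardSuperconductivity-19154 /
-19155, shared research statement `OnePointLipschitz`, census (C3d′) (memo §7, steps S2–S3).  Generic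
closure lemmas for PARAMETRISED polymer functionals `F : ℂ → 𝓟 → (fields → ℂ)`:

* `contDiff_line_activity`, `differentiable_line_activity` — `(σ, φ) ↦ (K + σV)(Y, φ)` is jointly `C^n`
  when `K Y, V Y ∈ C^n`, and affine (entire) in `σ`;
* `contDiff_pcirc_param`, `differentiable_pcirc_param` — circle products `(F_σ ∘ G_σ)(X)` of families that
  are jointly `C^n` / entire are jointly `C^n` / entire (finite sums of products);
* `contDiff_bprod_param`, `differentiable_bprod_param` — the same for block products of one-block families;
* **`contDiff_midK_line`**, **`differentiable_midK_line`** — for the data of [ABKM19] (6.32) along the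
  line `(H + σU, K + σV)` with an intermediate Hamiltonian family `σ ↦ H̃ + σŨ` (affine, as `nextH` is
  linear in `(H, K)`): `(σ, φ) ↦ Φ_σ(X, φ, ξ)` is jointly `C^n` (for `K, V ∈ C^n` blockwise) and
  `σ ↦ Φ_σ(X, φ, ξ)` is entire, for every `X, φ, ξ`.

All proved, no `sorry`.

## References
* S. Adams, S. Buchholz, R. Kotecký, S. Müller, arXiv:1910.13564, Definition 6.5, (6.32), Ch. 6.2
  [AdamsBuchholzKoteckyMuller2019].
-/

noncomputable section

-- `Summit.<Summit>.<Problem>`: single-conjunct summit, the duplicate component is mandated (D-0017).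
set_option linter.dupNamespace false

namespace Summit.HubbardSuperconductivity.HubbardSuperconductivity.Theorems.ComplexGFF

open Literature.MathematicalPhysics.StatisticalMechanics.GradientRG
open Literature.MathematicalPhysics.StatisticalMechanics.TorusPolymer (bprod blocks pcirc polys)
open Literature.MathematicalPhysics.StatisticalMechanics

variable {d M : ℕ} [NeZero M]

/-! ### Activities along an affine line `K + σV` -/

/-- `(σ, φ) ↦ K(Y, φ) + σ·V(Y, φ)` is jointly `C^n` when `K(Y,·), V(Y,·)` are. -/
theorem contDiff_line_activity {n : WithTop ℕ∞} {K V : Finset (Fin d → ZMod M) → ((Fin d → ZMod M) → ℝ) → ℂ}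
    (Y : Finset (Fin d → ZMod M)) (hK : ContDiff ℝ n (K Y)) (hV : ContDiff ℝ n (V Y)) :
    ContDiff ℝ n (fun p : ℂ × ((Fin d → ZMod M) → ℝ) => K Y p.2 + p.1 * V Y p.2) :=
  (hK.comp contDiff_snd).add (contDiff_fst.mul (hV.comp contDiff_snd))

omit [NeZero M] in
/-- `σ ↦ K(Y, φ) + σ·V(Y, φ)` is entire. -/
theorem differentiable_line_activity (K V : Finset (Fin d → ZMod M) → ((Fin d → ZMod M) → ℝ) → ℂ)
    (Y : Finset (Fin d → ZMod M)) (φ : (Fin d → ZMod M) → ℝ) :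
    Differentiable ℂ (fun σ : ℂ => K Y φ + σ * V Y φ) :=
  (differentiable_const _).add (differentiable_id.mul (differentiable_const _))

/-! ### Closure of "jointly `C^n` and entire in `σ`" under block and circle products -/

/-- block products of a parametrised one-block family that is jointly `C^n` are jointly `C^n`. -/
theorem contDiff_bprod_param {n : WithTop ℕ∞} (s : ℕ)
    {F : ℂ × ((Fin d → ZMod M) → ℝ) → Finset (Fin d → ZMod M) → ℂ}
    (hF : ∀ B, ContDiff ℝ n (fun p : ℂ × ((Fin d → ZMod M) → ℝ) => F p B)) (Z : Finset (Fin d → ZMod M)) :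
    ContDiff ℝ n (fun p : ℂ × ((Fin d → ZMod M) → ℝ) => bprod s (F p) Z) := by
  unfold bprod
  exact contDiff_prod fun B _ => hF B

/-- block products of a one-block family entire in `σ` are entire in `σ`. -/
theorem differentiable_bprod_param (s : ℕ) {F : ℂ → Finset (Fin d → ZMod M) → ℂ}
    (hF : ∀ B, Differentiable ℂ (fun σ => F σ B)) (Z : Finset (Fin d → ZMod M)) :
    Differentiable ℂ (fun σ : ℂ => bprod s (F σ) Z) := by
  unfold bprod
  have h := Differentiable.finsetProd (u := blocks s Z) fun B _ => hF B
  rw [Finset.prod_fn] at h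
  exact h

/-- circle products of parametrised polymer families that are jointly `C^n` are jointly `C^n`. -/
theorem contDiff_pcirc_param {n : WithTop ℕ∞} (s : ℕ)
    {F G : ℂ × ((Fin d → ZMod M) → ℝ) → Finset (Fin d → ZMod M) → ℂ}
    (hF : ∀ Y, ContDiff ℝ n (fun p : ℂ × ((Fin d → ZMod M) → ℝ) => F p Y))
    (hG : ∀ Y, ContDiff ℝ n (fun p : ℂ × ((Fin d → ZMod M) → ℝ) => G p Y)) (X : Finset (Fin d → ZMod M)) :
    ContDiff ℝ n (fun p : ℂ × ((Fin d → ZMod M) → ℝ) => pcirc s (F p) (G p) X) := by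
  unfold pcirc
  exact ContDiff.sum fun Y _ => (hF Y).mul (hG (X \ Y))

/-- circle products of polymer families entire in `σ` are entire in `σ`. -/
theorem differentiable_pcirc_param (s : ℕ) {F G : ℂ → Finset (Fin d → ZMod M) → ℂ}
    (hF : ∀ Y, Differentiable ℂ (fun σ => F σ Y)) (hG : ∀ Y, Differentiable ℂ (fun σ => G σ Y))
    (X : Finset (Fin d → ZMod M)) :
    Differentiable ℂ (fun σ : ℂ => pcirc s (F σ) (G σ) X) := by
  unfold pcirc
  have h := Differentiable.sum (𝕜 := ℂ) (u := polys s X) (A := fun Y σ => F σ Y * G σ (X \ Y))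
    (fun Y _ => (hF Y).mul (hG (X \ Y)))
  rw [Finset.sum_fn] at h
  exact h

/-! ### The intermediate functional `Φ = midK` of (6.32) along the line `(H + σU, K + σV)` -/

/-- **`(σ, φ) ↦ Φ_σ(X, φ, ξ)` is jointly `C^n`** for `I = e^{−(H+σU)}`, `Ĩ = e^{−(H̃+σŨ)}`, `K + σV` with
`K(Y,·), V(Y,·) ∈ C^n` for all `Y` (fixed `ξ`). -/
theorem contDiff_midK_line {n : WithTop ℕ∞} (s : ℕ) (H U Ht Ut : RelevantHamiltonian ℂ d)
    {K V : Finset (Fin d → ZMod M) → ((Fin d → ZMod M) → ℝ) → ℂ}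
    (hK : ∀ Y, ContDiff ℝ n (K Y)) (hV : ∀ Y, ContDiff ℝ n (V Y))
    (X : Finset (Fin d → ZMod M)) (ξ : (Fin d → ZMod M) → ℝ) :
    ContDiff ℝ n (fun p : ℂ × ((Fin d → ZMod M) → ℝ) =>
      midK s (expNegH (H + p.1 • U)) (expNegH (Ht + p.1 • Ut)) (fun Y φ => K Y φ + p.1 * V Y φ) X p.2 ξ) := by
  unfold midK
  refine contDiff_pcirc_param s (F := fun p Y => bprod s (fun B => 1 - expNegH (Ht + p.1 • Ut) B p.2) Y)
    (G := fun p Y => pcirc s (bprod s fun B => expNegH (H + p.1 • U) B (p.2 + ξ) - 1)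
      (fun Y' => K Y' (p.2 + ξ) + p.1 * V Y' (p.2 + ξ)) Y)
    (fun Y => contDiff_bprod_one_sub_expNegH_line s Ht Ut Y) (fun Y => ?_) X
  refine contDiff_pcirc_param s (F := fun p Y' => bprod s (fun B => expNegH (H + p.1 • U) B (p.2 + ξ) - 1) Y')
    (G := fun p Y' => K Y' (p.2 + ξ) + p.1 * V Y' (p.2 + ξ)) (fun Y' => ?_) (fun Y' => ?_) Y
  · have h := (contDiff_bprod_expNegH_sub_one_line s H U Y' (n := n)).comp
      (contDiff_fst.prodMk (contDiff_snd.add contDiff_const) :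
        ContDiff ℝ n (fun p : ℂ × ((Fin d → ZMod M) → ℝ) => ((p.1, p.2 + ξ) : ℂ × ((Fin d → ZMod M) → ℝ))))
    exact h
  · exact ((hK Y').comp (contDiff_snd.add contDiff_const)).add
      (contDiff_fst.mul ((hV Y').comp (contDiff_snd.add contDiff_const)))

omit [NeZero M] in
/-- auxiliary: entire dependence of the translated activity. -/
theorem differentiable_line_activity_add (K V : Finset (Fin d → ZMod M) → ((Fin d → ZMod M) → ℝ) → ℂ)
    (Y : Finset (Fin d → ZMod M)) (φ ξ : (Fin d → ZMod M) → ℝ) :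
    Differentiable ℂ (fun σ : ℂ => K Y (φ + ξ) + σ * V Y (φ + ξ)) :=
  differentiable_line_activity K V Y (φ + ξ)

/-- **`σ ↦ Φ_σ(X, φ, ξ)` is entire** for every `X, φ, ξ`. -/
theorem differentiable_midK_line (s : ℕ) (H U Ht Ut : RelevantHamiltonian ℂ d)
    (K V : Finset (Fin d → ZMod M) → ((Fin d → ZMod M) → ℝ) → ℂ)
    (X : Finset (Fin d → ZMod M)) (φ ξ : (Fin d → ZMod M) → ℝ) :
    Differentiable ℂ (fun σ : ℂ =>
      midK s (expNegH (H + σ • U)) (expNegH (Ht + σ • Ut)) (fun Y ψ => K Y ψ + σ * V Y ψ) X φ ξ) := by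
  unfold midK
  refine differentiable_pcirc_param s (F := fun σ Y => bprod s (fun B => 1 - expNegH (Ht + σ • Ut) B φ) Y)
    (G := fun σ Y => pcirc s (bprod s fun B => expNegH (H + σ • U) B (φ + ξ) - 1)
      (fun Y' => K Y' (φ + ξ) + σ * V Y' (φ + ξ)) Y)
    (fun Y => differentiable_bprod_one_sub_expNegH_line s Ht Ut Y φ) (fun Y => ?_) X
  exact differentiable_pcirc_param s (F := fun σ Y' => bprod s (fun B => expNegH (H + σ • U) B (φ + ξ) - 1) Y')
    (G := fun σ Y' => K Y' (φ + ξ) + σ * V Y' (φ + ξ))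
    (fun Y' => differentiable_bprod_expNegH_sub_one_line s H U Y' (φ + ξ))
    (fun Y' => differentiable_line_activity_add K V Y' φ ξ) Y

end Summit.HubbardSuperconductivity.HubbardSuperconductivity.Theorems.ComplexGFF

end
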